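import Summits.HodgeConjecture.HodgeConjecture.Cruxes.BlochSeedDiscOne.BnCCertCover5
import Summits.HodgeConjecture.HodgeConjecture.Cruxes.BlochSeedDiscOne.BnCCertCover6
import Summits.HodgeConjecture.HodgeConjecture.Cruxes.BlochSeedDiscOne.BnCCertCover7

/-!
# BnCCertCover8 — module 8 (dual g12, 2026-08-30): assembly of image 3's N-pass and the hypothesis-free (U2) half-region theorem

Chains module 6's chunks `N6_c0 … N6_c7` and module 7's `N7_c8 … N7_c15` (their predicates `QN6 = QN7` and column lists `colsN6 = colsN7` are the same
terms, so the chain unifies definitionally) into `pass3N : PassOK lf3 Side.N`, and with module 5's `pass3P` closes both hypotheses of module 4's end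
theorem: `Replay4273.halfRegion4273_m3bPresent` — no design on the alphabet of height 6 with A1, A4, `copies ≤ 199`, `rank ≥ 8`, the caps of node
4273 and the class `m³b` present on the P side.  This is the (U2) closure «the m³b-present half of region 4273 is empty at B = 199» replayed in the
kernel from the MODEL-grade certificate `cert4273-m3b-present-otl1.v3.json` 72d6afbf8b2121fc.  Nothing here is proved toward `FloorFree 6 199 8` ∕ 18881 ∕ H2 ∕ HC: chunk lemmas of one image's ordered pass are evidence that a MODEL-grade certificate replays, not a floor statement.
-/

set_option autoImplicit false

namespace Summit.HodgeConjecture.HodgeConjecture.Cruxes.BlochSeedDiscOne.BnCCertCover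

open Summit.HodgeConjecture.HodgeConjecture.Cruxes.BlochSeedDiscOne.DepthBoundA4
open Summit.HodgeConjecture.HodgeConjecture.Cruxes.BlochSeedDiscOne.RingFiveEmpty
open Summit.HodgeConjecture.HodgeConjecture.Cruxes.BlochSeedDiscOne.BnCCert

namespace Replay4273

theorem lenN : colsN6.length ≤ 1360 := le_trans img3_repsN_le (by decide)

theorem allN : colsN6.all QN6 = true :=
  all_of_drop_zero _ _ (all_drop_of_chunk _ _ _ _ N6_c0 (all_drop_of_chunk _ _ _ _ N6_c1 (all_drop_of_chunk _ _ _ _ N6_c2 (all_drop_of_chunk _ _ _ _ N6_c3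
    (all_drop_of_chunk _ _ _ _ N6_c4 (all_drop_of_chunk _ _ _ _ N6_c5 (all_drop_of_chunk _ _ _ _ N6_c6 (all_drop_of_chunk _ _ _ _ N6_c7
    (all_drop_of_chunk _ _ _ _ N7_c8 (all_drop_of_chunk _ _ _ _ N7_c9 (all_drop_of_chunk _ _ _ _ N7_c10 (all_drop_of_chunk _ _ _ _ N7_c11
    (all_drop_of_chunk _ _ _ _ N7_c12 (all_drop_of_chunk _ _ _ _ N7_c13 (all_drop_of_chunk _ _ _ _ N7_c14 (all_drop_of_chunk _ _ _ _ N7_c15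
    (all_drop_of_length_le _ _ _ lenN)))))))))))))))))

/-- **image 3's ordered N-pass** -/
theorem pass3N : PassOK lf3 Side.N := checkPtO_of_allR (LeafO.stabInv3_of_OK C5 lf3 γ0 Side.N img3_stab3OK) allN

/-- **(U2) replayed**: the `m³b`-present half of region 4273 is empty at `B = 199` (no hypotheses beyond the region's). -/
theorem halfRegion4273_m3bPresent (D : Design) (hA : D.OnAlphabet 6) (h1 : D.A1) (h4 : D.A4) (hB : D.copies ≤ 199) (hr : (8 : ℤ) ≤ D.rank)
    (hcaps : InCaps vars8 caps8 D) (hpres : Present D Side.P o3) : False :=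
  halfRegion4273_m3bPresent_empty pass3N pass3P D hA h1 h4 hB hr hcaps hpres

end Replay4273

end Summit.HodgeConjecture.HodgeConjecture.Cruxes.BlochSeedDiscOne.BnCCertCover
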